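/- Copyright: the b2b-balaban cell (near-miss cell 7), T⁴-continuum fan-out, lineage t4-ne7b-formalise-leaf-06 (NE7b CRUX
TEAM (2) leaf prover 06), gen 32: «THE ROUNDING WINDOW», file 2∕3.  Released under the licence of the surrounding project. -/
import Summits.QuantumFields.BalabanUV.T4Continuum.Support.HistoryBankingSharpShares
import Summits.QuantumFields.BalabanUV.T4Continuum.Support.HistoryBankingCreditRead
import Literature.MathematicalPhysics.QuantumFieldTheory.Balaban1983to89.B16LargeFieldFactors380
import Literature.MathematicalPhysics.QuantumFieldTheory.Balaban1983to89.B16Sect1Kernels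

/-!
# History banking, M5-3 (γ′) file 2∕3: THE ROUNDING-WITH-ROOM JUNCTION `RoundingRoom` HOLDS AT PRINT'S SHARP EXPONENT
LETTERS ON A DISPLAYED, K-UNIFORM COUPLING WINDOW (route R-P1 of row NE7b; re-open object (α), `WALL-NE7b-P1.md` v1.19 §2
row `price` ∕ §5 (o), located residue (γ′))

Summits-side support leaf of the T⁴-continuum cell (rung (B)+1 on a FINITE torus only; NOT infinite volume, NOT the
mass gap, NOT the Clay statement; NOT a proof of the spine estimate NE7b — the cell's OWN estimate, NOT PRINTED, NOT
PROVED).  [folklore] real arithmetic over the lineage's own carriers: the sibling `HistoryBankingSharpShares` (letters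
`ell`, `sRsharp`, `sBsharp`, `S0`, the share envelope `uEnv`), the OWNER t4-ne7b-p1 g45's row-S21 modules
`HistoryBankingDiscountCharge` (`dshare`, `mshare`, `structure RoundingRoom`) and `HistoryBankingCreditRead` (`FactorRead`,
`evProd_le_exp_neg_credits_mul_exp_neg_discount`), the typed (2.9) `B14FlowStep.FlowIneq29` and (2.5) `B14.IsRj` ∕
`B14FlowStep.isRj_le_mul_logpow`, and two Literature LOCATORS used only in the §3 bridges (`B16Sect1Kernels.ExponentProviso383`,
`B16LargeFieldFactors380.{minConst, min_eq_A1sq}`); no `[cite:]` tag, nothing printed asserted, no `def … : Prop` fact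
(`SharpWindow` is a displayed HYPOTHESIS structure — a smallness condition on OUR letters, discharged in the sibling
`HistoryBankingRoundingSupply` from ONE threshold `ℓ_j ≥ ℓ⋆`, hence from `g_j ≤ γ ≤ e^{−ℓ⋆∕2}`), zero `sorry`.

WHY.  WALL v1.19 §2 row `price` ∕ §5 (o): after M5-3 the CREDIT part of `priceM` at `κ := costT` is kernel modulo the two
located R-class displays `FactorRead` (VALUES of M2-B's factors) and `RoundingRoom` (print's two roundings — (1.79) p. 383
of the fundamental factor of p. 381, and «we estimate the factors by exp(−p₀(g_j))» p. 383 after (1.78) — READ WITH ROOM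
for the count's per-event discount shares), the sharp letters `sB`, `sR` being «balaban-calc's to instantiate»; the
owner located the discharge «for print's exponents it is „g sufficiently small“, discharged in arithmetic from
`B16Sect1Kernels.ExponentProviso383` + the END's pay-clause family once `sB`∕`sR` are instantiated» (R-OWNER-45-1,
F-ne7bp1g45-1; refuter PRICING-NE7b v12.1 F69; calc G26 «NE7b-ROOM-1 SERVED»: the same arithmetic in floats).  THIS FILE
is that discharge in the kernel: AT PRINT'S SHARP LETTERS (`sBsharp`, `sRsharp` of the sibling) `RoundingRoom` is a
THEOREM on an explicit, K-uniform coupling window — so (γ′)'s `RoundingRoom` leaves the R-list for print's letters, and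
what the plug (IR-45-1 ∕ IR-46-1, S12-W crew) still DISPLAYS on the credit side is `FactorRead (fB K) (fR K) (sBsharp …)
(sRsharp …)` — the identification of M2 brick B's factor VALUES with print's (1.77)–(1.78) ∕ p. 381 factors (H3) — and
the window (a `ForSmallCouplings`-type smallness).  THE MULTIPLIER `(1+Φ)`: both clauses are proved with room
`(1+Φ)·(shares)` for a free `Φ ≥ 0`, so that the OWNER g46's fibre form `RoundingRoomF … φB φR` (R-OWNER-46-1 (c), M5-4a
`HistoryBankingFibreRoom` p274013) follows for any fibre share `φB ≤ Φ·dshare(birth)`, `φR ≤ Φ·dshare(renewal)` (the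
sibling `HistoryBankingRoundingSupply.roundingRoomF_sharp`); `Φ = 0` is g45's `RoundingRoom` verbatim.  THE SIZE POWER `t`
of the renewal letter is free: `t = d + 5` is the instantiation of record (print's rounded right member, R-OWNER-45-1 ∕
calc G26.2), `t = d + 3` a lower envelope of the UNROUNDED left member `S_h` that refuter PRICING-NE7b v13 L-v13-1 prefers
(`N_h = R_h`, `β₀(d+2) ≤ 1`; a factor reading at `S_h` implies one at the envelope).

WHAT.  §1 **`structure SharpWindow C O L K r p₁ t η η′ κ Ap₁ Φ g`** (display): exponent bookkeeping `p₀ + r·t + η = 2p₁`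
(at the size power of record `t = d+5`: the proviso in ℕ-form, gap `η`), `r(q′+1) + r·t + η′ = 2p₁`, `r(q′+1) + κ = 2p₀`;
`1 ≤ ℓ_j`; and for `j ≤ K`: (WR1) `2A₀L^{t} ≤ Ap₁²ℓ_j^{η}`, (WR2) `48(1+Φ)L^{3(q′+1)}L^{t} ≤ Ap₁²ℓ_j^{η′}`, (WB1) `8 ≤ γ₀A₁²A₀ℓ_j^{p₀}`, (WB2)
`4(1+Φ)S₀L^{3(q′+1)} ≤ γ₀A₁²A₀²ℓ_j^{κ}`.  **`renew_clause`**: `pcredit + (1+Φ)·dshare ≤ sRsharp t Ap₁ p₁ R g h` for every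
performed renewal (`h = step − 1`; the sharp exponent multiplied out by `R_h^{t} ≤ L^{t}ℓ_h^{rt}`, (WR1)·ℓ^{p₀+rt} and
(WR2)·ℓ^{r(q′+1)+rt} each pay HALF of `Ap₁²ℓ^{2p₁}`).  **`birth_clause`**: `pcredit + (1+Φ)·(dshare + mshare s) ≤
sBsharp O m C g j d′` for every `j ≤ s ≤ K` and every `m ≥ A₁²` (the quadratic room `½γ₀A₁²P²(d′+1)` pays `2P` by (WB1)
and the shares `≤ (d′+1)·u^{q′+1}·S₀` by (WB2), a quarter each).  **`roundingRoom_sharp`**: `RoundingRoom C O L K R g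
(sBsharp O m C g) (sRsharp t Ap₁ p₁ R g)` under (2.9), the (2.5) envelope + `1 ≤ R_j`, `E₂ > 0`, `E₃ ≥ 0`, `L ≥ 1`,
`γ₀ ≥ 0`, `A₀ ≥ 0`, `A₁² ≤ m`, the window.  §2 BRIDGES:
**`exponentProviso383_of_expR`** (at `t = d+5`, `η ≥ 1` ⇒ `B16Sect1Kernels.ExponentProviso383 p₀ p₁ r d` over ℝ);
`neg_sRsharp_eq` (the letter at `t = d+5` IS `lfFactor178`'s right exponent); **`A1sq_le_minConst`** (ledger R2 `2B₃²A₁² ≤ A₀′²` ⇒ `A₁² ≤ minConst B₃ A₀′ A₁`,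
by `min_eq_A1sq`) and **`roundingRoom_sharp_minConst`**; **`envelope_of_isRj`** ((2.5) `B14.IsRj` + `1 ≤ ℓ_j` ⇒ the
envelope AND `1 ≤ R_j`) and **`roundingRoom_sharp_of_isRj`** (the size hypotheses from the witness's `isRj` field shape).  §3 **`evProd_le_of_factorRead_sharp`**: row S21's credit reading with its `RoundingRoom`
hypothesis DISCHARGED — junction BY NAME.  The reduction of the window to ONE threshold `ℓ_j ≥ ℓ⋆` and to the coupling
form `0 < g_j ≤ γ ≤ e^{−ℓ⋆∕2}`, and the OWNER's fibre junction `RoundingRoomF` at the same letters, are the third sibling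
`HistoryBankingRoundingSupply`.

CENSUS NOTE (kernel-invisible numbers about OUR window; calc G26 of record): under the (2.5) envelope `R_h ≤ L·ℓ_h^{r}`
the binding clause is (WR1) ⇔ `ℓ ≥ (2L^{t}A₀∕Ap₁²)^{1∕η}`; at the census letters (d, L, r, p₀, p₁) = (4, 13, 2, 23, 21),
`t = d + 5 = 9` (`η = 1`, `η′ = 12`, `κ = 34`) this is `ℓ ≥ 2·13⁹·A₀∕Ap₁²` — cf. G26.5's `13⁹A₀∕A₁²` (their `A₁` = this `Ap₁`; the 2 is
this file's halving); (WR2)∕(WB1)∕(WB2) are mild.  Constants stay SYMBOLIC here (trigger c2∕c6).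

HONEST SCOPE.  Real arithmetic over OUR carriers; `SharpWindow` is a HYPOTHESIS shape (a smallness of OUR letters,
reducible to `g_j ≤ γ ≤ e^{−ℓ⋆∕2}`); nothing of H3 ∕ (B) ∕ BetaPertH is discharged; what stays displayed after this file is
`FactorRead (fB K) (fR K) (sBsharp …) (sRsharp …)` (the VALUES of M2 brick B's factors below print's sharp exponents — H3's
identification) and the window.  Nothing of Bałaban's is asserted or contested: «g_j sufficiently small» is typed as an
explicit window, nothing more.  NE7b NOT PRINTED ∕ NOT PROVED; spine 0∕9; rung (B)+1 on a FINITE torus — NOT infinite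
volume, NOT the mass gap, NOT Clay.  HONEST DEPENDENCY (cell): continuum YM on T⁴ ⇐ BetaPertH ∧ nine spine estimates (0/9
proved); BetaPertH ⇐ (D1) ∧ (D4) ∧ CAP+tail; G-an2-4 gates asym, D1 and NE2/3/4.  This file changes none of it.
-/

open Finset
open Literature.MathematicalPhysics.QuantumFieldTheory.Balaban1983to89
open T4PersistenceDictionary T4PrintedShapeBanking T4BankedInduction T4TaggedShapeBanking T4PartnerMultiplicity
open Summit.QuantumFields.BalabanUV.T4Continuum.HistoryBankingLE
open Summit.QuantumFields.BalabanUV.T4Continuum.HistoryConstants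
open Summit.QuantumFields.BalabanUV.T4Continuum.HistoryBankingDiscountCharge
open Summit.QuantumFields.BalabanUV.T4Continuum.HistoryBankingSharpShares

namespace Summit.QuantumFields.BalabanUV.T4Continuum.HistoryBankingRoundingWindow

noncomputable section

/-! ## §1 The displayed window, the two clauses, `RoundingRoom` -/

section Window

/-- **THE ROUNDING WINDOW** (HYPOTHESIS SHAPE — a `ForSmallCouplings`-type smallness of the run's couplings, K-UNIFORM:
every clause reads one step's `ℓ_j = log g_j⁻²` against constants; the sibling `HistoryBankingRoundingSupply` reduces it to
ONE threshold `ℓ_j ≥ ℓ⋆`, hence to `g_j ≤ γ ≤ e^{−ℓ⋆∕2}`).  Letters: `r` the (2.5) exponent, `p₁`∕`Ap₁` of `p₁(g) = Ap₁·ℓ^{p₁}`, `t` the size power of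
the sharp renewal letter (`d + 5` of record), `C.p₀`∕`C.A₀` the profile, `C.q′` the floor power; `η`, `η′`, `κ` the three exponent GAPS fixed by the bookkeeping
equations (`expR` is the exponent proviso of [B16] p. 383 «2p₁ − (d+5)r₀ > p₀» in ℕ-form with gap `η`, §2); `Φ ≥ 0` a
free multiplier reserving room `(1+Φ)·(shares)` (for a fibre share `≤ Φ·dshare`, R-OWNER-46-1).  The four clauses
(all `j ≤ K`): (WR1) `2·A₀·L^{t} ≤ Ap₁²·ℓ_j^{η}` — the booked renewal credit `p₀(g_h)` against HALF the sharp
exponent; (WR2) `48(1+Φ)·L^{3(q′+1)}·L^{t} ≤ Ap₁²·ℓ_j^{η′}` — the renewal's share against the other half; (WB1)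
`8 ≤ γ₀A₁²·A₀·ℓ_j^{p₀}` — the birth's `2p₀(g_j)` against a quarter of the quadratic room; (WB2)
`4(1+Φ)·S₀·L^{3(q′+1)} ≤ γ₀A₁²·A₀²·ℓ_j^{κ}` — the birth's shares against another quarter.  Nothing of Bałaban's is
asserted: the structure is a smallness condition on OUR letters. [folklore] -/
structure SharpWindow (C : T4PrintedShapeBanking.Consts) (O : PrintedO1s) (L K r p₁ t η η' κ : ℕ) (Ap₁ Φ : ℝ)
    (g : ℕ → ℝ) : Prop where
  /-- exponent bookkeeping of the renewal credit: `p₀ + r·t + η = 2p₁` (at `t = d+5`: the proviso, gap `η`) -/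
  expR : C.p₀ + r * t + η = 2 * p₁
  /-- exponent bookkeeping of the renewal share: `r(q′+1) + r·t + η′ = 2p₁` -/
  expR' : r * (C.q' + 1) + r * t + η' = 2 * p₁
  /-- exponent bookkeeping of the birth shares: `r(q′+1) + κ = 2p₀` -/
  expB : r * (C.q' + 1) + κ = 2 * C.p₀
  /-- the logarithms are at least one on the performed range -/
  one_le_ell : ∀ j, j ≤ K → 1 ≤ ell g j
  /-- (WR1) -/
  wR1 : ∀ j, j ≤ K → 2 * C.A₀ * (L : ℝ) ^ t ≤ Ap₁ ^ 2 * ell g j ^ η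
  /-- (WR2) -/
  wR2 : ∀ j, j ≤ K → 48 * (1 + Φ) * (L : ℝ) ^ (3 * (C.q' + 1)) * (L : ℝ) ^ t ≤ Ap₁ ^ 2 * ell g j ^ η'
  /-- (WB1) -/
  wB1 : ∀ j, j ≤ K → 8 ≤ O.γ₀ * O.A₁ ^ 2 * C.A₀ * ell g j ^ C.p₀
  /-- (WB2) -/
  wB2 : ∀ j, j ≤ K →
    4 * (1 + Φ) * S0 C * (L : ℝ) ^ (3 * (C.q' + 1)) ≤ O.γ₀ * O.A₁ ^ 2 * C.A₀ ^ 2 * ell g j ^ κ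

variable {C : T4PrintedShapeBanking.Consts} {O : PrintedO1s} {L K r p₁ t η η' κ : ℕ} {Ap₁ Φ m : ℝ} {R : ℕ → ℕ}
  {g : ℕ → ℝ} {β' β₀ : ℝ}

/-- **THE RENEWAL CLAUSE WITH ROOM `(1+Φ)`**: for a kind-`1` event at a performed step `s = h + 1 ≤ K`,
`pcredit + (1+Φ)·dshare ≤ sRsharp d Ap₁ p₁ R g h` on the window ((2.9), the (2.5) envelope, `R ≥ 1`, `A₀ ≥ 0`,
`Φ ≥ 0`). [folklore] -/
theorem renew_clause (hL : 1 ≤ L) (hA₀ : 0 ≤ C.A₀) (hΦ : 0 ≤ Φ)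
    (h29 : B14FlowStep.FlowIneq29 R g L β' β₀ K) (hRup : ∀ j, j ≤ K → (R j : ℝ) ≤ L * ell g j ^ r)
    (hR1 : ∀ j, j ≤ K → 1 ≤ R j) (hW : SharpWindow C O L K r p₁ t η η' κ Ap₁ Φ g)
    {e : PEv} (he : e.kind = 1) (hK : e.step ≤ K) :
    pcredit O C g e + (1 + Φ) * dshare C L R e ≤ sRsharp t Ap₁ p₁ R g (e.step - 1) := by
  set h := e.step - 1 with hh
  have hhs : h ≤ e.step := Nat.sub_le _ _
  have hhK : h ≤ K := hhs.trans hK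
  have hℓ := hW.one_le_ell h hhK
  have hℓ0 : 0 ≤ ell g h := by linarith
  obtain ⟨hu1, hRh, -, hRs, hLRs⟩ := sizes_le_uEnv h29 hL hhs hK (hRup h hhK) hℓ
  set u := uEnv L r g h with hu
  have hu0 : 0 ≤ u := by linarith
  -- the share and the credit
  have hds := dshare_kind1_le_of_size_le (C := C) hu1 he hRs hLRs
  rw [pcredit_kind1 he, p0Profile_eq]
  -- the sharp exponent as a quotient and the size power from above
  have hRpos : (0 : ℝ) < (R h : ℝ) ^ t := by
    have : (1 : ℝ) ≤ R h := by exact_mod_cast hR1 h hhK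
    positivity
  have hRpow : (R h : ℝ) ^ t ≤ (L : ℝ) ^ t * ell g h ^ (r * t) := by
    calc (R h : ℝ) ^ t ≤ ((L : ℝ) * ell g h ^ r) ^ t :=
          pow_le_pow_left₀ (Nat.cast_nonneg _) (hRup h hhK) _
      _ = (L : ℝ) ^ t * ell g h ^ (r * t) := by rw [mul_pow, ← pow_mul]
  unfold sRsharp
  rw [← hh, inv_mul_eq_div, le_div_iff₀ hRpos]
  -- the two halves
  have hA : C.A₀ * ell g h ^ C.p₀ * ((L : ℝ) ^ t * ell g h ^ (r * t)) ≤
      Ap₁ ^ 2 * ell g h ^ (2 * p₁) / 2 := by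
    have hw := hW.wR1 h hhK
    have hpp : 0 ≤ ell g h ^ C.p₀ * ell g h ^ (r * t) := by positivity
    have key := mul_le_mul_of_nonneg_right hw hpp
    have hexp : ell g h ^ η * (ell g h ^ C.p₀ * ell g h ^ (r * t)) = ell g h ^ (2 * p₁) := by
      rw [← pow_add, ← pow_add, ← hW.expR]; ring_nf
    calc C.A₀ * ell g h ^ C.p₀ * ((L : ℝ) ^ t * ell g h ^ (r * t))
        = (2 * C.A₀ * (L : ℝ) ^ t) * (ell g h ^ C.p₀ * ell g h ^ (r * t)) / 2 := by ring
      _ ≤ Ap₁ ^ 2 * ell g h ^ η * (ell g h ^ C.p₀ * ell g h ^ (r * t)) / 2 := by linarith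
      _ = Ap₁ ^ 2 * ell g h ^ (2 * p₁) / 2 := by rw [mul_assoc, hexp]
  have hB : (1 + Φ) * (24 * u ^ (C.q' + 1)) * ((L : ℝ) ^ t * ell g h ^ (r * t)) ≤
      Ap₁ ^ 2 * ell g h ^ (2 * p₁) / 2 := by
    have hw := hW.wR2 h hhK
    rw [hu, uEnv_pow]
    have hpp : 0 ≤ ell g h ^ (r * (C.q' + 1)) * ell g h ^ (r * t) := by positivity
    have key := mul_le_mul_of_nonneg_right hw hpp
    have hexp : ell g h ^ η' * (ell g h ^ (r * (C.q' + 1)) * ell g h ^ (r * t)) = ell g h ^ (2 * p₁) := by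
      rw [← pow_add, ← pow_add, ← hW.expR']; ring_nf
    calc (1 + Φ) * (24 * ((L : ℝ) ^ (3 * (C.q' + 1)) * ell g h ^ (r * (C.q' + 1)))) *
          ((L : ℝ) ^ t * ell g h ^ (r * t))
        = (48 * (1 + Φ) * (L : ℝ) ^ (3 * (C.q' + 1)) * (L : ℝ) ^ t) *
            (ell g h ^ (r * (C.q' + 1)) * ell g h ^ (r * t)) / 2 := by ring
      _ ≤ Ap₁ ^ 2 * ell g h ^ η' * (ell g h ^ (r * (C.q' + 1)) * ell g h ^ (r * t)) / 2 := by linarith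
      _ = Ap₁ ^ 2 * ell g h ^ (2 * p₁) / 2 := by rw [mul_assoc, hexp]
  -- assemble
  have hlhs0 : 0 ≤ C.A₀ * ell g h ^ C.p₀ + (1 + Φ) * dshare C L R e := by
    have : 0 ≤ dshare C L R e := by
      rw [dshare_kind1_eq he]; have : (0 : ℝ) ≤ R e.step := Nat.cast_nonneg _; positivity
    positivity
  have hsq : (Ap₁ * ell g h ^ p₁) ^ 2 = Ap₁ ^ 2 * ell g h ^ (2 * p₁) := by rw [mul_pow, ← pow_mul, mul_comm p₁ 2]
  calc (C.A₀ * ell g h ^ C.p₀ + (1 + Φ) * dshare C L R e) * (R h : ℝ) ^ t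
      ≤ (C.A₀ * ell g h ^ C.p₀ + (1 + Φ) * dshare C L R e) *
          ((L : ℝ) ^ t * ell g h ^ (r * t)) := mul_le_mul_of_nonneg_left hRpow hlhs0
    _ ≤ (C.A₀ * ell g h ^ C.p₀ + (1 + Φ) * (24 * u ^ (C.q' + 1))) *
          ((L : ℝ) ^ t * ell g h ^ (r * t)) := by
        apply mul_le_mul_of_nonneg_right _ (by positivity)
        have := mul_le_mul_of_nonneg_left hds (by linarith : (0 : ℝ) ≤ 1 + Φ)
        linarith
    _ = C.A₀ * ell g h ^ C.p₀ * ((L : ℝ) ^ t * ell g h ^ (r * t)) +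
          (1 + Φ) * (24 * u ^ (C.q' + 1)) * ((L : ℝ) ^ t * ell g h ^ (r * t)) := by ring
    _ ≤ Ap₁ ^ 2 * ell g h ^ (2 * p₁) / 2 + Ap₁ ^ 2 * ell g h ^ (2 * p₁) / 2 := add_le_add hA hB
    _ = (Ap₁ * ell g h ^ p₁) ^ 2 := by rw [hsq]; ring

/-- **THE BIRTH CLAUSE WITH ROOM `(1+Φ)`**: for a kind-`0` event of class `d′` at step `j` and every later performed step
`j ≤ s ≤ K`, `pcredit + (1+Φ)·(dshare + mshare s) ≤ sBsharp O m C g j d′` on the window, for any min-letter `m ≥ A₁²`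
((2.9), the (2.5) envelope, `E₂ > 0`, `E₃ ≥ 0`, `γ₀ ≥ 0`, `A₀ ≥ 0`, `Φ ≥ 0`). [folklore] -/
theorem birth_clause (hE₂ : 0 < C.E₂) (hE₃ : 0 ≤ C.E₃) (hL : 1 ≤ L) (hγ₀ : 0 ≤ O.γ₀) (hA₀ : 0 ≤ C.A₀)
    (hΦ : 0 ≤ Φ) (hm : O.A₁ ^ 2 ≤ m)
    (h29 : B14FlowStep.FlowIneq29 R g L β' β₀ K) (hRup : ∀ j, j ≤ K → (R j : ℝ) ≤ L * ell g j ^ r)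
    (hW : SharpWindow C O L K r p₁ t η η' κ Ap₁ Φ g)
    {e : PEv} (he : e.kind = 0) {s : ℕ} (hjs : e.step ≤ s) (hsK : s ≤ K) :
    pcredit O C g e + (1 + Φ) * (dshare C L R e + mshare C L R s) ≤ sBsharp O m C g e.step e.fat := by
  set j := e.step with hj
  have hjK : j ≤ K := hjs.trans hsK
  have hℓ := hW.one_le_ell j hjK
  have hℓ0 : 0 ≤ ell g j := by linarith
  obtain ⟨hu1, hRj, hLRj, hRs, hLRs⟩ := sizes_le_uEnv h29 hL hjs hsK (hRup j hjK) hℓ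
  set u := uEnv L r g j with hu
  set D : ℝ := (e.fat : ℝ) + 1 with hD
  have hD1 : 1 ≤ D := by rw [hD]; have : (0 : ℝ) ≤ e.fat := Nat.cast_nonneg _; linarith
  have hD0 : 0 ≤ D := by linarith
  set P : ℝ := C.A₀ * ell g j ^ C.p₀ with hP
  have hP0 : 0 ≤ P := by rw [hP]; positivity
  -- shares ≤ D·u^{q'+1}·S₀
  have hds := dshare_kind0_le_of_size_le (C := C) hE₂ hE₃ hu1 he hRj hLRj
  have hms := mshare_le_of_size_le (C := C) (L := L) hE₂ hE₃ hu1 hRs hLRs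
  have huq0 : 0 ≤ u ^ (C.q' + 1) := by positivity
  have hρ : 0 ≤ C.E₃ / C.E₂ := div_nonneg hE₃ hE₂.le
  have hn₁ : (0 : ℝ) ≤ C.n₁ := Nat.cast_nonneg _
  have hdC : (0 : ℝ) ≤ C.dC := Nat.cast_nonneg _
  have hshares : dshare C L R e + mshare C L R s ≤ D * u ^ (C.q' + 1) * S0 C := by
    have hm' : mshare C L R s ≤ D * (u ^ (C.q' + 1) * (12 + 12 * (C.n₁ : ℝ) + 8 * (C.E₃ / C.E₂) * (C.dC : ℝ))) :=
      hms.trans (le_mul_of_one_le_left (by positivity) hD1)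
    calc dshare C L R e + mshare C L R s
        ≤ D * u ^ (C.q' + 1) * (36 + 8 * (C.E₃ / C.E₂)) +
          D * (u ^ (C.q' + 1) * (12 + 12 * (C.n₁ : ℝ) + 8 * (C.E₃ / C.E₂) * (C.dC : ℝ))) := add_le_add hds hm'
      _ = D * u ^ (C.q' + 1) * S0 C := by unfold S0; ring
  -- (WB2): shares against a quarter of the quadratic room
  have hB2 : (1 + Φ) * (D * u ^ (C.q' + 1) * S0 C) ≤ O.γ₀ * O.A₁ ^ 2 / 4 * P ^ 2 * D := by
    have hw := hW.wB2 j hjK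
    rw [hu, uEnv_pow]
    have hpp : 0 ≤ ell g j ^ (r * (C.q' + 1)) * D := by positivity
    have key := mul_le_mul_of_nonneg_right hw hpp
    have hexp : ell g j ^ κ * ell g j ^ (r * (C.q' + 1)) = ell g j ^ (2 * C.p₀) := by
      rw [← pow_add, ← hW.expB]; ring_nf
    have hPsq : P ^ 2 = C.A₀ ^ 2 * ell g j ^ (2 * C.p₀) := by rw [hP, mul_pow, ← pow_mul, mul_comm C.p₀ 2]
    calc (1 + Φ) * (D * ((L : ℝ) ^ (3 * (C.q' + 1)) * ell g j ^ (r * (C.q' + 1))) * S0 C)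
        = (4 * (1 + Φ) * S0 C * (L : ℝ) ^ (3 * (C.q' + 1))) * (ell g j ^ (r * (C.q' + 1)) * D) / 4 := by ring
      _ ≤ O.γ₀ * O.A₁ ^ 2 * C.A₀ ^ 2 * ell g j ^ κ * (ell g j ^ (r * (C.q' + 1)) * D) / 4 := by linarith
      _ = O.γ₀ * O.A₁ ^ 2 / 4 * (C.A₀ ^ 2 * (ell g j ^ κ * ell g j ^ (r * (C.q' + 1)))) * D := by ring
      _ = O.γ₀ * O.A₁ ^ 2 / 4 * P ^ 2 * D := by rw [hexp, hPsq]
  -- (WB1): the linear term against another quarter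
  have hB1 : 2 * P ≤ O.γ₀ * O.A₁ ^ 2 / 4 * P ^ 2 * D := by
    have hw : 8 ≤ O.γ₀ * O.A₁ ^ 2 * P := by
      have := hW.wB1 j hjK; rw [hP]; linarith
    have h8 : 8 ≤ O.γ₀ * O.A₁ ^ 2 * P * D := by
      have h0 : 0 ≤ O.γ₀ * O.A₁ ^ 2 * P := by positivity
      calc (8 : ℝ) ≤ O.γ₀ * O.A₁ ^ 2 * P := hw
        _ ≤ O.γ₀ * O.A₁ ^ 2 * P * D := le_mul_of_one_le_right h0 hD1
    have h1 : 8 * P ≤ O.γ₀ * O.A₁ ^ 2 * P * D * P := mul_le_mul_of_nonneg_right h8 hP0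
    have h2 : O.γ₀ * O.A₁ ^ 2 * P * D * P = 4 * (O.γ₀ * O.A₁ ^ 2 / 4 * P ^ 2 * D) := by ring
    linarith
  -- the sharp exponent dominates the booked quadratic credit twice
  have hsB : O.γ₀ * O.A₁ ^ 2 * P ^ 2 * D ≤ sBsharp O m C g j e.fat := by
    unfold sBsharp
    rw [p0Profile_eq, ← hP, ← hD]
    have h1 : O.γ₀ * O.A₁ ^ 2 ≤ O.γ₀ * m := mul_le_mul_of_nonneg_left hm hγ₀
    have h2 : O.γ₀ * O.A₁ ^ 2 * (P ^ 2 * D) ≤ O.γ₀ * m * (P ^ 2 * D) :=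
      mul_le_mul_of_nonneg_right h1 (by positivity)
    calc O.γ₀ * O.A₁ ^ 2 * P ^ 2 * D = O.γ₀ * O.A₁ ^ 2 * (P ^ 2 * D) := by ring
      _ ≤ O.γ₀ * m * (P ^ 2 * D) := h2
      _ = O.γ₀ * m * P ^ 2 * D := by ring
  rw [pcredit_kind0 he, p0Profile_eq, ← hj, ← hP, ← hD]
  have hsh : (1 + Φ) * (dshare C L R e + mshare C L R s) ≤ O.γ₀ * O.A₁ ^ 2 / 4 * P ^ 2 * D :=
    (mul_le_mul_of_nonneg_left hshares (by linarith)).trans hB2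
  have hquad : O.γ₀ * O.A₁ ^ 2 / 2 * P ^ 2 * D + O.γ₀ * O.A₁ ^ 2 / 4 * P ^ 2 * D +
      O.γ₀ * O.A₁ ^ 2 / 4 * P ^ 2 * D = O.γ₀ * O.A₁ ^ 2 * P ^ 2 * D := by ring
  linarith

/-- **`RoundingRoom` AT PRINT'S SHARP EXPONENT LETTERS ON THE WINDOW**: g45's displayed junction
`HistoryBankingDiscountCharge.RoundingRoom C O L K R g (sBsharp O m C g) (sRsharp t Ap₁ p₁ R g)` HOLDS under (2.9)
`FlowIneq29 R g L β′ β₀ K`, the (2.5) envelope `R_j ≤ L·ℓ_j^{r}` with `1 ≤ R_j` (`j ≤ K`), `E₂ > 0`, `E₃ ≥ 0`, `L ≥ 1`,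
`γ₀ ≥ 0`, `A₀ ≥ 0`, any min-letter `m ≥ A₁²`, and the window `SharpWindow C O L K r p₁ η η′ κ Ap₁ Φ g` for some
`Φ ≥ 0`. [folklore] -/
theorem roundingRoom_sharp (hE₂ : 0 < C.E₂) (hE₃ : 0 ≤ C.E₃) (hL : 1 ≤ L) (hγ₀ : 0 ≤ O.γ₀) (hA₀ : 0 ≤ C.A₀)
    (hΦ : 0 ≤ Φ) (hm : O.A₁ ^ 2 ≤ m)
    (h29 : B14FlowStep.FlowIneq29 R g L β' β₀ K) (hRup : ∀ j, j ≤ K → (R j : ℝ) ≤ L * ell g j ^ r)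
    (hR1 : ∀ j, j ≤ K → 1 ≤ R j) (hW : SharpWindow C O L K r p₁ t η η' κ Ap₁ Φ g) :
    RoundingRoom C O L K R g (sBsharp O m C g) (sRsharp t Ap₁ p₁ R g) where
  birth e he s hjs hsK := by
    have h := birth_clause hE₂ hE₃ hL hγ₀ hA₀ hΦ hm h29 hRup hW he hjs hsK
    have h0 : 0 ≤ Φ * (dshare C L R e + mshare C L R s) :=
      mul_nonneg hΦ (add_nonneg (dshare_nonneg hE₂.le hE₃ e) (mshare_nonneg hE₂.le hE₃ s))
    linarith
  renew e he _ hK := by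
    have h := renew_clause hL hA₀ hΦ h29 hRup hR1 hW he hK
    have h0 : 0 ≤ Φ * dshare C L R e := mul_nonneg hΦ (dshare_nonneg hE₂.le hE₃ e)
    linarith

end Window

/-! ## §2 Bridges to the printed loci: the exponent proviso of p. 383 and the p. 381 minimum under the ledger relation -/

section Bridges

variable {C : T4PrintedShapeBanking.Consts} {O : PrintedO1s} {r p₁ η d : ℕ}

/-- the renewal bookkeeping at the printed size power `t = d + 5`, `p₀ + r(d+5) + η = 2p₁`, with a POSITIVE gap `η ≥ 1`
IS [B16] p. 383's exponent proviso
«2p₁ − (d + 5)r₀ > p₀» (`B16Sect1Kernels.ExponentProviso383`, over ℝ). [folklore] -/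
theorem exponentProviso383_of_expR (h : C.p₀ + r * (d + 5) + η = 2 * p₁) (hη : 1 ≤ η) :
    B16Sect1Kernels.ExponentProviso383 (C.p₀ : ℝ) (p₁ : ℝ) (r : ℝ) d := by
  unfold B16Sect1Kernels.ExponentProviso383
  have h' : (C.p₀ : ℝ) + r * (d + 5) + η = 2 * p₁ := by exact_mod_cast h
  have hη' : (1 : ℝ) ≤ η := by exact_mod_cast hη
  rw [show (2 : ℝ) * p₁ - ((d : ℝ) + 5) * r = C.p₀ + η by rw [← h']; ring]
  linarith

/-- the sharp renewal letter, negated, IS the exponent of `lfFactor178`'s right member `exp(−R_j^{−d−5}p₁²(g_j))` at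
`p₁(g_h) = Ap₁·ℓ_h^{p₁}` (syntactic bridge). [folklore] -/
theorem neg_sRsharp_eq (d : ℕ) (Ap₁ : ℝ) (p₁ : ℕ) (R : ℕ → ℕ) (g : ℕ → ℝ) (h : ℕ) :
    -sRsharp (d + 5) Ap₁ p₁ R g h = -((R h : ℝ) ^ (d + 5))⁻¹ * (Ap₁ * ell g h ^ p₁) ^ 2 := by
  unfold sRsharp; ring

/-- under the ledger relation `2B₃²A₁² ≤ A₀′²` (GAPS G-B16-07 R2; the refuter's (P♯)) the printed minimum
`min{½B₃⁻²A₀′², 2A₁², A₁²}` of p. 381 is `A₁²`, so the birth clause's `A₁² ≤ m` holds at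
`m = B16LargeFieldFactors380.minConst B₃ A₀′ A₁`. [folklore] -/
theorem A1sq_le_minConst {B₃ A₀' : ℝ} (hB₃ : B₃ ≠ 0) (hR2 : 2 * B₃ ^ 2 * O.A₁ ^ 2 ≤ A₀' ^ 2) :
    O.A₁ ^ 2 ≤ B16LargeFieldFactors380.minConst B₃ A₀' O.A₁ :=
  (B16LargeFieldFactors380.min_eq_A1sq hB₃ hR2).ge

variable {L K t κ η' : ℕ} {Ap₁ Φ m : ℝ} {R : ℕ → ℕ} {g : ℕ → ℝ} {β' β₀ : ℝ}

/-- **`RoundingRoom` AT PRINT'S p. 381 MINIMUM**: `roundingRoom_sharp` with `m := minConst B₃ A₀′ A₁` under R2. [folklore] -/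
theorem roundingRoom_sharp_minConst {B₃ A₀' : ℝ} (hB₃ : B₃ ≠ 0) (hR2 : 2 * B₃ ^ 2 * O.A₁ ^ 2 ≤ A₀' ^ 2)
    (hE₂ : 0 < C.E₂) (hE₃ : 0 ≤ C.E₃) (hL : 1 ≤ L) (hγ₀ : 0 ≤ O.γ₀) (hA₀ : 0 ≤ C.A₀) (hΦ : 0 ≤ Φ)
    (h29 : B14FlowStep.FlowIneq29 R g L β' β₀ K) (hRup : ∀ j, j ≤ K → (R j : ℝ) ≤ L * ell g j ^ r)
    (hR1 : ∀ j, j ≤ K → 1 ≤ R j) (hW : SharpWindow C O L K r p₁ t η η' κ Ap₁ Φ g) :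
    RoundingRoom C O L K R g (sBsharp O (B16LargeFieldFactors380.minConst B₃ A₀' O.A₁) C g)
      (sRsharp t Ap₁ p₁ R g) :=
  roundingRoom_sharp hE₂ hE₃ hL hγ₀ hA₀ hΦ (A1sq_le_minConst hB₃ hR2) h29 hRup hR1 hW

/-- the (2.5) envelope and `1 ≤ R_j` FROM (2.5) ITSELF: `B14.IsRj L r (g_j) (R_j)` with `1 ≤ ℓ_j`, `L ≥ 1` gives
`R_j ≤ L·ℓ_j^{r}` (`B14FlowStep.isRj_le_mul_logpow`) and `1 ≤ R_j` (`R_j` is a power of `L`). [folklore] -/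
theorem envelope_of_isRj (hL : 1 ≤ L) {j : ℕ} (hR : B14.IsRj L r (g j) (R j)) (hℓ : 1 ≤ ell g j) :
    (R j : ℝ) ≤ L * ell g j ^ r ∧ 1 ≤ R j := by
  refine ⟨B14FlowStep.isRj_le_mul_logpow hL hR (one_le_pow₀ hℓ), ?_⟩
  obtain ⟨s, hs, -, -⟩ := hR
  rw [hs]
  exact Nat.one_le_pow _ _ (by omega)

/-- **`RoundingRoom` AT PRINT'S SHARP LETTERS FROM (2.5) ITSELF**: `roundingRoom_sharp` with the size hypotheses supplied by
`B14.IsRj L r (g_j) (R_j)` for `j ≤ K` (the witness's `isRj` field shape) through `envelope_of_isRj`. [folklore] -/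
theorem roundingRoom_sharp_of_isRj (hE₂ : 0 < C.E₂) (hE₃ : 0 ≤ C.E₃) (hL : 1 ≤ L) (hγ₀ : 0 ≤ O.γ₀) (hA₀ : 0 ≤ C.A₀)
    (hΦ : 0 ≤ Φ) (hm : O.A₁ ^ 2 ≤ m) (h29 : B14FlowStep.FlowIneq29 R g L β' β₀ K)
    (hRj : ∀ j, j ≤ K → B14.IsRj L r (g j) (R j)) (hW : SharpWindow C O L K r p₁ t η η' κ Ap₁ Φ g) :
    RoundingRoom C O L K R g (sBsharp O m C g) (sRsharp t Ap₁ p₁ R g) :=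
  roundingRoom_sharp hE₂ hE₃ hL hγ₀ hA₀ hΦ hm h29
    (fun j hj => (envelope_of_isRj hL (hRj j hj) (hW.one_le_ell j hj)).1)
    (fun j hj => (envelope_of_isRj hL (hRj j hj) (hW.one_le_ell j hj)).2) hW

end Bridges

/-! ## §3 The credit reading on the window (junction BY NAME with row S21's `HistoryBankingCreditRead`) -/

section Credit

variable {γ : Type*} {ε : Type*} [DecidableEq ε] (sh : ε → PEv) {C : T4PrintedShapeBanking.Consts} {O : PrintedO1s}
  {L K r p₁ t η η' κ : ℕ} {Ap₁ Φ m : ℝ} {R : ℕ → ℕ} {g : ℕ → ℝ} {β' β₀ : ℝ} {fB : ℕ → ℕ → γ → ℝ} {fR : ℕ → ℝ}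

/-- **THE CREDIT READING (M5-3) ON THE WINDOW**: with the event-wise factor reading AT PRINT'S SHARP LETTERS
`FactorRead fB fR (sBsharp O m C g) (sRsharp t Ap₁ p₁ R g)` as the ONE remaining display, (2.9), the (2.5) envelope,
`1 ≤ R_j`, `E₂ > 0`, `E₃ ≥ 0`, `L ≥ 1`, `γ₀ ≥ 0`, `A₀ ≥ 0`, `A₁² ≤ m`, and the window: for a `ConsistentTLE`, well-formed
tagged genealogy `G` whose shape-relabelling is `P`'s canonical genealogy,
`evProd fB fR P ≤ exp (−credits (pcredit O C g ∘ sh) G) · exp (−Ξ(G))` — row S21's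
`evProd_le_exp_neg_credits_mul_exp_neg_discount` with its `RoundingRoom` hypothesis DISCHARGED by `roundingRoom_sharp`.
[folklore] -/
theorem evProd_le_of_factorRead_sharp (hF : HistoryBankingCreditRead.FactorRead fB fR (sBsharp O m C g) (sRsharp t Ap₁ p₁ R g))
    (hE₂ : 0 < C.E₂) (hE₃ : 0 ≤ C.E₃) (hL : 1 ≤ L) (hγ₀ : 0 ≤ O.γ₀) (hA₀ : 0 ≤ C.A₀) (hΦ : 0 ≤ Φ)
    (hm : O.A₁ ^ 2 ≤ m) (h29 : B14FlowStep.FlowIneq29 R g L β' β₀ K)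
    (hRup : ∀ j, j ≤ K → (R j : ℝ) ≤ L * ell g j ^ r) (hR1 : ∀ j, j ≤ K → 1 ≤ R j)
    (hWin : SharpWindow C O L K r p₁ t η η' κ Ap₁ Φ g) {P : HistoryAdmissible.PGen γ} {G : Gen ε}
    (hsh : T4BranchingRecordsGas.relabel sh G = P.toGen) (hW : G.WF (dictWT sh R C.n₁))
    (hc : ConsistentTLE sh C K R G) :
    HistoryGenealogyExtraction.evProd fB fR P ≤ Real.exp (-credits (pcredit O C g ∘ sh) G) *
      Real.exp (-(8 / C.E₂ * totalCostT sh C K R G + 4 * (partnerAges (PEv.step ∘ sh) G : ℝ))) :=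
  HistoryBankingCreditRead.evProd_le_exp_neg_credits_mul_exp_neg_discount sh hF
    (roundingRoom_sharp hE₂ hE₃ hL hγ₀ hA₀ hΦ hm h29 hRup hR1 hWin) h29 hL hE₂ hE₃ hsh hW hc

end Credit

end

end Summit.QuantumFields.BalabanUV.T4Continuum.HistoryBankingRoundingWindow
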